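import Literature.MathematicalPhysics.QuantumLattice.HubbardUVSymbolJets
import HarnessLib

/-!
# The GEOMETRIC everywhere-envelope of the band jets of the ultraviolet symbol: `‖∂_eⁿ Ψ(ω, e)‖ ≤ |c|·X·n!·(4/Λ)^{n+1}` at EVERY band value

Topic `MathematicalPhysics/QuantumLattice`; sequel of `HubbardUVSymbolJets` (`norm_iteratedFDeriv_uvSymbolFnXi_le`: the envelope
`n!·X·|c|·Σ_{i≤n} D(e)^i/max(|ω|,Λ/2)^{n+1−i}`, `D(e) = 2|e|/Λ² + 2/Λ`, sharp near the shell but growing like `|e|ⁿ/Λ^{2n}` far above it, where the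
symbol is in truth the bare resolvent).  Splitting the band axis into BELOW the shell (`ω²+e² < Λ²/4`: all jets vanish), the SHELL
(`Λ²/4 ≤ ω²+e² ≤ Λ²`: `|e| ≤ Λ`, so `D(e) ≤ 4/Λ` and `max(|ω|,Λ/2) ≥ Λ/2`) and ABOVE it (`Λ² < ω²+e²`: locally `Ψ = R`, the resolvent, whose jets are
`|c|·n!/‖−iω+e‖^{n+1} ≤ |c|·n!/Λ^{n+1}`) gives ONE geometric bound, uniform in the band — the shape the aliasing/sup route of the K3 two-leg reading
needs (cell gate-hubbard-kl, stub (C) «(C)-B-REP», memo SUP-ROUTE-SPEC §2(c): factor norms `A·B_M·M!·(C/Λ)^M` composed with frame jets):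

* `uvSymbolFnXi_eventuallyEq_resolvent_of_gt` — above the shell `Ψ = R` near `e`; `iteratedFDeriv_uvSymbolFnXi_eq_resolvent_of_gt`;
* `norm_iteratedFDeriv_uvSymbolFnXi_le_of_gt` — `‖∂ⁿΨ(e)‖ ≤ |c|·n!/Λ^{n+1}` above the shell;
* `norm_iteratedFDeriv_uvSymbolFnXi_le_of_shell` — `‖∂ⁿΨ(e)‖ ≤ |c|·X·n!·(4/Λ)^{n+1}` on the closed shell;
* **`norm_iteratedFDeriv_uvSymbolFnXi_le_geometric`** — `‖∂ⁿΨ(e)‖ ≤ |c|·X·n!·(4/Λ)^{n+1}` for EVERY `e` (`0 < Λ`, `ω ≠ 0`, cutoff table `‖χ₂^{(l)}‖ ≤ X`, `l ≤ n`,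
  `1 ≤ X`).

Everything is proved; no definitions; no named facts.

## Sources

G. Benfatto, A. Giuliani, V. Mastropietro, Ann. Henri Poincaré 7 (2006) 809–898, §2.2 (2.36aa), App. A1 [`BenfattoGiulianiMastropietro2006`];
M. Salmhofer, *Renormalization* (Springer 1999), §4.2.5 (4.70)–(4.71) [`Salmhofer1999`].
-/

noncomputable section

namespace Literature.MathematicalPhysics.QuantumLattice

open Complex Finset

variable {c Λ ω : ℝ}

/-- **Above the shell the symbol IS the resolvent near `e`**: `Λ² < ω² + e² ⟹ Ψ =ᶠ[𝓝 e] R`. [cite: Salmhofer1999, §4.2.5 (4.71)] -/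
theorem uvSymbolFnXi_eventuallyEq_resolvent_of_gt (hΛ : 0 < Λ) {e : ℝ} (h : Λ ^ 2 < ω ^ 2 + e ^ 2) :
    uvSymbolFnXi c Λ ω =ᶠ[nhds e] resolventFnXi c 0 ω := by
  have hlt : Λ ^ 2 < e ^ 2 + ω ^ 2 := by linarith
  have hopen : ∀ᶠ t in nhds e, Λ ^ 2 < t ^ 2 + ω ^ 2 :=
    (continuous_pow 2 |>.add continuous_const).continuousAt.eventually (lt_mem_nhds hlt)
  filter_upwards [hopen] with t ht
  rw [uvSymbolFnXi, (uvWeightFn_eq_one_of_gt hΛ (e := ω) (ω := t) (by linarith)).1, Complex.ofReal_one, one_mul]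

/-- Above the shell every band jet of `Ψ` is the corresponding jet of the resolvent. [cite: Salmhofer1999, §4.2.5 (4.71)] -/
theorem iteratedFDeriv_uvSymbolFnXi_eq_resolvent_of_gt (hΛ : 0 < Λ) {e : ℝ} (h : Λ ^ 2 < ω ^ 2 + e ^ 2) (n : ℕ) :
    iteratedFDeriv ℝ n (uvSymbolFnXi c Λ ω) e = iteratedFDeriv ℝ n (resolventFnXi c 0 ω) e :=
  ((uvSymbolFnXi_eventuallyEq_resolvent_of_gt hΛ h).iteratedFDeriv ℝ n).eq_of_nhds

/-- **Above the shell**: `‖∂ⁿΨ(e)‖ ≤ |c|·n!/Λ^{n+1}` (`‖−iω+e‖ = √(ω²+e²) > Λ`). [cite: BenfattoGiulianiMastropietro2006, §2.2 (2.36aa)] -/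
theorem norm_iteratedFDeriv_uvSymbolFnXi_le_of_gt (hΛ : 0 < Λ) (hω : ω ≠ 0) {e : ℝ} (h : Λ ^ 2 < ω ^ 2 + e ^ 2) (n : ℕ) :
    ‖iteratedFDeriv ℝ n (uvSymbolFnXi c Λ ω) e‖ ≤ |c| * n.factorial / Λ ^ (n + 1) := by
  have hω0 : ω + 0 ≠ 0 := by rwa [add_zero]
  rw [iteratedFDeriv_uvSymbolFnXi_eq_resolvent_of_gt hΛ h, norm_iteratedFDeriv_eq_norm_iteratedDeriv, norm_iteratedDeriv_resolventFnXi hω0]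
  have hden : Λ ≤ ‖-I * ((ω + 0 : ℝ) : ℂ) + (e : ℂ)‖ := by
    refine (abs_le_of_sq_le_sq' ?_ (norm_nonneg _)).2
    rw [norm_sq_uvDen]; exact h.le
  exact div_le_div_of_nonneg_left (by positivity) (by positivity) (pow_le_pow_left₀ hΛ.le hden _)

/-- **On the closed shell** `Λ²/4 ≤ ω²+e² ≤ Λ²`: `‖∂ⁿΨ(e)‖ ≤ |c|·X·n!·(4/Λ)^{n+1}` (`D(e) ≤ 4/Λ`, envelope `≥ Λ/2`, `Σ_{i≤n} 4ⁱ2^{n+1−i} ≤ 4^{n+1}`).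
[cite: BenfattoGiulianiMastropietro2006, §2.2 (2.36aa)] -/
theorem norm_iteratedFDeriv_uvSymbolFnXi_le_of_shell (hΛ : 0 < Λ) (hω : ω ≠ 0) {n : ℕ} {X : ℝ}
    (hX : ∀ l ≤ n, ∀ x : ℝ, ‖iteratedFDeriv ℝ l salmhoferCutoff x‖ ≤ X) {e : ℝ} (h : ω ^ 2 + e ^ 2 ≤ Λ ^ 2) :
    ‖iteratedFDeriv ℝ n (uvSymbolFnXi c Λ ω) e‖ ≤ |c| * X * n.factorial * (4 / Λ) ^ (n + 1) := by
  have hX0 : 0 ≤ X := (norm_nonneg _).trans (hX 0 (Nat.zero_le _) 0)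
  have hm : Λ / 2 ≤ max |ω| (Λ / 2) := le_max_right _ _
  have hm0 : 0 < Λ / 2 := by positivity
  -- `|e| ≤ Λ`, so `D(e) ≤ 4/Λ`
  have he : |e| ≤ Λ := abs_le.2 (abs_le_of_sq_le_sq' (by nlinarith [sq_nonneg ω]) hΛ.le)
  have hD : 2 * |e| / Λ ^ 2 + 2 / Λ ≤ 4 / Λ := by
    rw [div_add_div _ _ (by positivity) hΛ.ne', div_le_div_iff₀ (by positivity) hΛ]
    nlinarith [abs_nonneg e]
  refine (norm_iteratedFDeriv_uvSymbolFnXi_le hΛ hω hX e).trans ?_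
  have hterm : ∀ i ∈ range (n + 1), (2 * |e| / Λ ^ 2 + 2 / Λ) ^ i / max |ω| (Λ / 2) ^ (n - i + 1) ≤ (4 / Λ) ^ i * (2 / Λ) ^ (n - i + 1) := by
    intro i _
    rw [div_eq_mul_inv]
    refine mul_le_mul (pow_le_pow_left₀ (by positivity) hD i) ?_ (by positivity) (by positivity)
    rw [← inv_pow, show (2 / Λ) = (Λ / 2)⁻¹ by rw [inv_div]]
    exact pow_le_pow_left₀ (by positivity) (inv_anti₀ hm0 hm) _
  have hsum : ∑ i ∈ range (n + 1), (4 / Λ) ^ i * (2 / Λ) ^ (n - i + 1) ≤ (4 / Λ) ^ (n + 1) := by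
    -- each term equals `2^{n+1+i}/Λ^{n+1}`; the sum is `2^{n+1}(2^{n+1}-1)/Λ^{n+1} ≤ 4^{n+1}/Λ^{n+1}`
    have hterm' : ∀ i ∈ range (n + 1), (4 / Λ) ^ i * (2 / Λ) ^ (n - i + 1) = (2 : ℝ) ^ (n + 1) * 2 ^ i / Λ ^ (n + 1) := by
      intro i hi
      have hin : i ≤ n := Nat.lt_succ_iff.1 (mem_range.1 hi)
      obtain ⟨k, rfl⟩ := Nat.exists_eq_add_of_le hin
      rw [show i + k - i + 1 = k + 1 by omega, show (4 : ℝ) / Λ = (2 / Λ) * 2 by ring, mul_pow, div_pow, div_pow]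
      field_simp
      ring
    have hgeom : ∑ i ∈ range (n + 1), (2 : ℝ) ^ i ≤ 2 ^ (n + 1) := by
      have := geom_sum_eq (x := (2 : ℝ)) (by norm_num) (n + 1)
      rw [this]; norm_num
    calc ∑ i ∈ range (n + 1), (4 / Λ) ^ i * (2 / Λ) ^ (n - i + 1) = (2 : ℝ) ^ (n + 1) * (∑ i ∈ range (n + 1), (2 : ℝ) ^ i) / Λ ^ (n + 1) := by
          rw [sum_congr rfl hterm', ← sum_div, ← mul_sum]
      _ ≤ (2 : ℝ) ^ (n + 1) * 2 ^ (n + 1) / Λ ^ (n + 1) := by gcongr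
      _ = (4 / Λ) ^ (n + 1) := by rw [div_pow, ← mul_pow]; norm_num
  calc (n.factorial : ℝ) * X * |c| * ∑ i ∈ range (n + 1), (2 * |e| / Λ ^ 2 + 2 / Λ) ^ i / max |ω| (Λ / 2) ^ (n - i + 1)
      ≤ (n.factorial : ℝ) * X * |c| * ∑ i ∈ range (n + 1), (4 / Λ) ^ i * (2 / Λ) ^ (n - i + 1) :=
        mul_le_mul_of_nonneg_left (sum_le_sum hterm) (by positivity)
    _ ≤ (n.factorial : ℝ) * X * |c| * (4 / Λ) ^ (n + 1) := mul_le_mul_of_nonneg_left hsum (by positivity)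
    _ = |c| * X * n.factorial * (4 / Λ) ^ (n + 1) := by ring

/-- **THE GEOMETRIC EVERYWHERE-ENVELOPE**: `‖∂ⁿΨ(ω, e)‖ ≤ |c|·X·n!·(4/Λ)^{n+1}` at EVERY band value `e` (`0 < Λ`, `ω ≠ 0`, cutoff-derivative table
`‖χ₂^{(l)}‖ ≤ X` for `l ≤ n`, `1 ≤ X`). [cite: BenfattoGiulianiMastropietro2006, §2.2 (2.36aa)] -/
theorem norm_iteratedFDeriv_uvSymbolFnXi_le_geometric (hΛ : 0 < Λ) (hω : ω ≠ 0) {n : ℕ} {X : ℝ} (hX1 : 1 ≤ X)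
    (hX : ∀ l ≤ n, ∀ x : ℝ, ‖iteratedFDeriv ℝ l salmhoferCutoff x‖ ≤ X) (e : ℝ) :
    ‖iteratedFDeriv ℝ n (uvSymbolFnXi c Λ ω) e‖ ≤ |c| * X * n.factorial * (4 / Λ) ^ (n + 1) := by
  by_cases h : ω ^ 2 + e ^ 2 ≤ Λ ^ 2
  · exact norm_iteratedFDeriv_uvSymbolFnXi_le_of_shell hΛ hω hX h
  · refine (norm_iteratedFDeriv_uvSymbolFnXi_le_of_gt hΛ hω (not_le.1 h) n).trans ?_
    have h4 : (1 : ℝ) ≤ 4 ^ (n + 1) := one_le_pow₀ (by norm_num)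
    rw [div_pow, show |c| * X * (n.factorial : ℝ) * (4 ^ (n + 1) / Λ ^ (n + 1)) = |c| * n.factorial / Λ ^ (n + 1) * (X * 4 ^ (n + 1)) by ring]
    exact le_mul_of_one_le_right (by positivity) (one_le_mul_of_one_le_of_one_le hX1 h4)

end Literature.MathematicalPhysics.QuantumLattice

end
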